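import Literature.NumberTheory.DiophantineGeometry.AbcShapeGeometrySets
import Literature.NumberTheory.DiophantineGeometry.AbcShapeSubBox

-- Summit.ABC.ABC is the mandated summit-side namespace (single-conjunct summit); the lakefile sets the same option tree-wide.
set_option linter.dupNamespace false

/-!
# Inexact short vectors are divisible by few host moduli (crux stmt-ABC-2757, stub `de_card_inexact_le`)

Stub H5b of the DE tool for the line `critical-kloosterman-powerful-moduli` of the crux
`Summit.ABC.ABC.Theses.TwistAmplification.MazurKaneLaw`.  In the energy bound of the DE tool the
host modulus is `q(r) = W_Q(r) = ∏_{i∈Q} rᵢ^{i+1}` (`AbcShapes.onVal Q r`) for a host tuple `r` in the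
sub-box `subBox Qᶜ X` (coordinates in `Q` free, the others frozen), and the lattices
`a ≡ λ b (mod q(r))` with an unusually short vector `(a, b)`, `|a|, |b| ≤ L`, force
`q(r) ∣ D' := a² F(C) - b² F(D)` with `F(C) = c₂ · offVal_{{i₀,i₁}}(C.1) · (c₃ · offVal_{{i₀,i₁}}(C.2))`
for parameter pairs `C, D ∈ subBox {i₀,i₁} Y × subBox {i₀,i₁} Z`.  This file
(`Summit.ABC.ABC.Theorems.MazurKaneLaw.de_card_inexact_le`) counts the *inexact* case `D' ≠ 0`:

* for fixed parameters `(a, C, b, D)` with `D' ≠ 0`, a host tuple `r` with `q(r) ∣ D'` has all its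
  free coordinates dividing `|D'|` (`rᵢ ∣ W_Q(r)` for `i ∈ Q`), so there are at most `τ(|D'|)^d` of
  them (`AbcShapes.card_subBox_filter_dvd_le`), and `0 < |D'| ≤ 8T³` since `a², b² ≤ L² ≤ 4T` and
  `F ≤ T²` (`c₂ offVal ≤ c₂ V(C.1) ≤ c₂ V(2Y) ≤ T`, same for the `c₃`-factor), whence
  `τ(|D'|) ≤ Dτ`;
* summing over the `(2L+1)² · (#subBox{i₀,i₁}Y · #subBox{i₀,i₁}Z)²` parameters
  (`Finset.card_le_mul_card_image`) gives the claim.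

No new definitions.
-/

namespace Summit.ABC.ABC.Theorems.MazurKaneLaw

open Finset
open Literature.NumberTheory.DiophantineGeometry
open Literature.NumberTheory.DiophantineGeometry.AbcShapes

/-- Host tuples whose modulus divides a fixed nonzero integer are few: if `0 < |D| ≤ 8T³` and
`τ(m) ≤ Dτ` for `1 ≤ m ≤ 8T³`, then `#{r ∈ subBox Qᶜ X : W_Q(r) ∣ D} ≤ Dτ^d`, because every free
coordinate `rᵢ`, `i ∈ Q`, divides `W_Q(r) ∣ |D|` (`AbcShapes.card_subBox_filter_dvd_le`). [folklore] -/
theorem de_card_subBox_filter_intDvd_le {d : ℕ} (Q : Finset (Fin d)) (X : Fin d → ℕ) {T Dτ : ℕ}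
    (hD : ∀ m : ℕ, m ≠ 0 → m ≤ 8 * T ^ 3 → m.divisors.card ≤ Dτ) {D : ℤ} (hD0 : D ≠ 0)
    (hD8 : |D| ≤ 8 * (T : ℤ) ^ 3) :
    ((subBox Qᶜ X).filter (fun r => ((onVal Q r : ℕ) : ℤ) ∣ D)).card ≤ Dτ ^ d := by
  have hm0 : D.natAbs ≠ 0 := Int.natAbs_ne_zero.mpr hD0
  have hm8 : D.natAbs ≤ 8 * T ^ 3 := by
    have h : ((D.natAbs : ℕ) : ℤ) ≤ ((8 * T ^ 3 : ℕ) : ℤ) := by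
      rw [Int.natCast_natAbs]; push_cast; exact hD8
    exact Nat.cast_le.mp h
  refine le_trans (card_subBox_filter_dvd_le Qᶜ X hm0 (fun r => ((onVal Q r : ℕ) : ℤ) ∣ D)
    fun r _ hr i hi => ?_) (Nat.pow_le_pow_left (hD _ hm0 hm8) d)
  have hi' : i ∈ Q := by rwa [mem_compl, not_not] at hi
  exact (dvd_onVal Q r hi').trans (Int.natCast_dvd.mp hr)

/-- Size of the inexact determinant: for `|a|, |b| ≤ L` with `L² ≤ 4T` and `F, G ≤ T²`,
`|a² F - b² G| ≤ a² F + b² G ≤ 4T · T² + 4T · T² = 8T³`. [folklore] -/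
theorem de_abs_sqDiff_le {L T : ℕ} (hL : L ^ 2 ≤ 4 * T) {a b : ℤ} (ha : a ∈ Icc (-(L : ℤ)) L)
    (hb : b ∈ Icc (-(L : ℤ)) L) {F G : ℕ} (hF : F ≤ T ^ 2) (hG : G ≤ T ^ 2) :
    |a ^ 2 * (F : ℤ) - b ^ 2 * (G : ℤ)| ≤ 8 * (T : ℤ) ^ 3 := by
  rw [mem_Icc] at ha hb
  have hL' : (L : ℤ) ^ 2 ≤ 4 * T := by exact_mod_cast hL
  have ha2 : a ^ 2 ≤ 4 * T := (sq_le_sq' ha.1 ha.2).trans hL'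
  have hb2 : b ^ 2 ≤ 4 * T := (sq_le_sq' hb.1 hb.2).trans hL'
  have hF' : (F : ℤ) ≤ (T : ℤ) ^ 2 := by exact_mod_cast hF
  have hG' : (G : ℤ) ≤ (T : ℤ) ^ 2 := by exact_mod_cast hG
  calc |a ^ 2 * (F : ℤ) - b ^ 2 * (G : ℤ)| ≤ |a ^ 2 * (F : ℤ)| + |b ^ 2 * (G : ℤ)| := abs_sub _ _
    _ = a ^ 2 * (F : ℤ) + b ^ 2 * (G : ℤ) := by
        rw [abs_of_nonneg (by positivity), abs_of_nonneg (by positivity)]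
    _ ≤ 4 * (T : ℤ) * (T : ℤ) ^ 2 + 4 * (T : ℤ) * (T : ℤ) ^ 2 :=
        add_le_add (mul_le_mul ha2 hF' (by positivity) (by positivity))
          (mul_le_mul hb2 hG' (by positivity) (by positivity))
    _ = 8 * (T : ℤ) ^ 3 := by ring

/-- The counting lemma behind `de_card_inexact_le`, with an abstract parameter set `CP` and an
abstract weight `Φ ≤ T²` on it: the `w = (r, ((a, C), (b, D)))` with `r ∈ subBox Qᶜ X`,
`a, b ∈ [-L, L]`, `C, D ∈ CP`, `(a, b) ≠ (0, 0)`, `D' = a² Φ(C) - b² Φ(D) ≠ 0` and `W_Q(r) ∣ D'`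
number at most `(2L+1)² · #CP² · Dτ^d`.  Proof: fibre over the parameter part `w.2`
(`Finset.card_le_mul_card_image`); on a fibre `D' ≠ 0` is fixed with `|D'| ≤ 8T³`
(`de_abs_sqDiff_le`) and `w ↦ r` is injective into `{r ∈ subBox Qᶜ X : W_Q(r) ∣ D'}`, of size
`≤ Dτ^d` (`de_card_subBox_filter_intDvd_le`); the parameters number `((2L+1) · #CP)²`. [folklore] -/
theorem de_card_inexact_aux {d : ℕ} (X : Fin d → ℕ) (Q : Finset (Fin d)) (L : ℕ) {T Dτ : ℕ}
    (CP : Finset ((Fin d → ℕ) × (Fin d → ℕ))) (Φ : (Fin d → ℕ) × (Fin d → ℕ) → ℕ)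
    (hD : ∀ m : ℕ, m ≠ 0 → m ≤ 8 * T ^ 3 → m.divisors.card ≤ Dτ) (hL : L ^ 2 ≤ 4 * T)
    (hΦ : ∀ C ∈ CP, Φ C ≤ T ^ 2) :
    ((subBox Qᶜ X ×ˢ ((Icc (-(L : ℤ)) L ×ˢ CP) ×ˢ (Icc (-(L : ℤ)) L ×ˢ CP))).filter
      (fun w : (Fin d → ℕ) × ((ℤ × ((Fin d → ℕ) × (Fin d → ℕ))) × (ℤ × ((Fin d → ℕ) × (Fin d → ℕ)))) =>
        (w.2.1.1, w.2.2.1) ≠ (0, 0) ∧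
        (w.2.1.1 ^ 2 * ((Φ w.2.1.2 : ℕ) : ℤ) - w.2.2.1 ^ 2 * ((Φ w.2.2.2 : ℕ) : ℤ)) ≠ 0 ∧
        ((onVal Q w.1 : ℕ) : ℤ) ∣
          (w.2.1.1 ^ 2 * ((Φ w.2.1.2 : ℕ) : ℤ) - w.2.2.1 ^ 2 * ((Φ w.2.2.2 : ℕ) : ℤ)))).card ≤
      (2 * L + 1) ^ 2 * CP.card ^ 2 * Dτ ^ d := by
  refine (Finset.card_le_mul_card_image (f := Prod.snd) _ (Dτ ^ d) fun p hp => ?_).trans ?_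
  · obtain ⟨w₀, hw₀, hw₀p⟩ := mem_image.mp hp
    obtain ⟨hw₀A, -, hD0, -⟩ := mem_filter.mp hw₀
    simp only [mem_product] at hw₀A
    obtain ⟨-, ⟨ha, hC⟩, ⟨hb, hC'⟩⟩ := hw₀A
    subst hw₀p
    refine le_trans (card_le_card_of_injOn (fun w => w.1) (fun w hw => ?_) (fun w hw w' hw' h => ?_))
      (de_card_subBox_filter_intDvd_le Q X hD hD0 (de_abs_sqDiff_le hL ha hb (hΦ _ hC) (hΦ _ hC')))
    · obtain ⟨hws, hw2⟩ := mem_filter.mp (mem_coe.mp hw)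
      obtain ⟨hwA, -, -, hdvd⟩ := mem_filter.mp hws
      have e : w.2 = w₀.2 := hw2
      rw [e] at hdvd
      exact mem_coe.mpr (mem_filter.mpr ⟨(mem_product.mp hwA).1, hdvd⟩)
    · obtain ⟨-, hw2⟩ := mem_filter.mp (mem_coe.mp hw)
      obtain ⟨-, hw2'⟩ := mem_filter.mp (mem_coe.mp hw')
      have e : w.2 = w₀.2 := hw2
      have e' : w'.2 = w₀.2 := hw2'
      exact Prod.ext h (e.trans e'.symm)
  · calc Dτ ^ d * _ ≤ Dτ ^ d * ((Icc (-(L : ℤ)) L ×ˢ CP) ×ˢ (Icc (-(L : ℤ)) L ×ˢ CP)).card :=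
          Nat.mul_le_mul_left _ (card_le_card (image_subset_iff.mpr fun w hw =>
            (mem_product.mp (mem_filter.mp hw).1).2))
      _ = (2 * L + 1) ^ 2 * CP.card ^ 2 * Dτ ^ d := by
          have h : ((L : ℤ) + 1 - -(L : ℤ)).toNat = 2 * L + 1 := by
            have h' : (L : ℤ) + 1 - -(L : ℤ) = ((2 * L + 1 : ℕ) : ℤ) := by push_cast; ring
            rw [h', Int.toNat_natCast]
          simp only [card_product, Int.card_Icc, h]
          ring

/-- In a sub-box of a box with positive corner `W` and `c · V(2W) ≤ T`, the off-part of the shape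
value satisfies `c · offVal_S(w) ≤ c · V(w) ≤ c · V(2W) ≤ T` (`V = offVal_S · W_S` with `W_S ≥ 1`,
and `V` is monotone). [folklore] -/
theorem de_mul_offVal_le {d : ℕ} {c T : ℕ} {W w : Fin d → ℕ} {S : Finset (Fin d)}
    (hW : ∀ j, 0 < W j) (hT : c * shapeVal (fun j => 2 * W j) ≤ T) (hw : w ∈ subBox S W) :
    c * offVal S w ≤ T := by
  have hw' := mem_dyadicBox.mp (subBox_subset hW hw)
  have hpos : ∀ j, 0 < w j := fun j => lt_of_lt_of_le (hW j) (hw' j).1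
  calc c * offVal S w ≤ c * shapeVal w := by
        rw [shapeVal_eq_offVal_mul_onVal S w]
        exact Nat.mul_le_mul_left _
          (Nat.le_mul_of_pos_right _ (prod_pos fun i _ => pow_pos (hpos i) _))
    _ ≤ c * shapeVal (fun j => 2 * W j) := Nat.mul_le_mul_left _ (shapeVal_mono fun j => (hw' j).2.le)
    _ ≤ T := hT

/-- **Inexact short vectors are divisible by few host moduli** (stub H5b `de_card_inexact_le` of
the DE tool, line `critical-kloosterman-powerful-moduli`): with `CP = subBox {i₀,i₁} Y × subBox {i₀,i₁} Z`,
`F(C) = c₂ · offVal_{{i₀,i₁}}(C.1) · (c₃ · offVal_{{i₀,i₁}}(C.2))`, the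
`w = (r, ((a, C), (b, D)))` with `r ∈ subBox Qᶜ X`, `a, b ∈ [-L, L]`, `C, D ∈ CP`, `(a, b) ≠ (0, 0)`,
`D' = a² F(C) - b² F(D) ≠ 0` and `W_Q(r) ∣ D'` number at most
`(2L+1)² · #subBox{i₀,i₁}Y² · #subBox{i₀,i₁}Z² · Dτ^d`, provided `τ(m) ≤ Dτ` for `1 ≤ m ≤ 8T³`,
`L² ≤ 4T`, `c₂ V(2Y), c₃ V(2Z) ≤ T`.  Proof: `de_card_inexact_aux` with `Φ = F ≤ T · T`
(`de_mul_offVal_le`), and `#CP = #subBox{i₀,i₁}Y · #subBox{i₀,i₁}Z`. [folklore] -/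
theorem de_card_inexact_le : ∀ {d : ℕ} (i₀ i₁ : Fin d) (c₂ c₃ : ℕ) (X Y Z : Fin d → ℕ) (Q : Finset (Fin d)) (L : ℕ) {T Dτ : ℕ}, (∀ m : ℕ, m ≠ 0 → m ≤ 8 * T ^ 3 → m.divisors.card ≤ Dτ) → L ^ 2 ≤ 4 * T → c₂ * shapeVal (fun j => 2 * Y j) ≤ T → c₃ * shapeVal (fun j => 2 * Z j) ≤ T → (∀ j, 0 < Y j) → (∀ j, 0 < Z j) → 0 < c₂ → 0 < c₃ → (((subBox Qᶜ X ×ˢ ((Finset.Icc (-(L : ℤ)) L ×ˢ (subBox ({i₀, i₁} : Finset (Fin d)) Y ×ˢ subBox ({i₀, i₁} : Finset (Fin d)) Z)) ×ˢ (Finset.Icc (-(L : ℤ)) L ×ˢ (subBox ({i₀, i₁} : Finset (Fin d)) Y ×ˢ subBox ({i₀, i₁} : Finset (Fin d)) Z)))).filter (fun w : (Fin d → ℕ) × ((ℤ × ((Fin d → ℕ) × (Fin d → ℕ))) × (ℤ × ((Fin d → ℕ) × (Fin d → ℕ)))) => (w.2.1.1, w.2.2.1) ≠ (0, 0) ∧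 ((w.2.1.1 ^ 2 * ((c₂ * offVal ({i₀, i₁} : Finset (Fin d)) w.2.1.2.1 * (c₃ * offVal ({i₀, i₁} : Finset (Fin d)) w.2.1.2.2)) : ℕ) : ℤ) - (w.2.2.1 ^ 2 * ((c₂ * offVal ({i₀, i₁} : Finset (Fin d)) w.2.2.2.1 * (c₃ * offVal ({i₀, i₁} : Finset (Fin d)) w.2.2.2.2)) : ℕ) : ℤ)) ≠ 0 ∧ ((onVal Q w.1 : ℕ) : ℤ) ∣ ((w.2.1.1 ^ 2 * ((c₂ * offVal ({i₀, i₁} : Finset (Fin d)) w.2.1.2.1 * (c₃ * offVal ({i₀, i₁} : Finset (Fin d)) w.2.1.2.2)) : ℕ) : ℤ) - (w.2.2.1 ^ 2 * ((c₂ * offVal ({i₀, i₁} : Finset (Fin d)) w.2.2.2.1 * (c₃ * offVal ({i₀, i₁} : Finset (Fin d)) w.2.2.2.2)) : ℕ) : ℤ))))).card ≤ (2 * L + 1) ^ 2 * (subBox ({i₀, i₁} : Finset (Fin d)) Y).card ^ 2 * (subBox ({i₀, i₁} : Finset (Fin d)) Z).card ^ 2 * Dτ ^ d := by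
  intro d i₀ i₁ c₂ c₃ X Y Z Q L T Dτ hD hL hTY hTZ hY hZ _ _
  have hΦ : ∀ C ∈ subBox ({i₀, i₁} : Finset (Fin d)) Y ×ˢ subBox ({i₀, i₁} : Finset (Fin d)) Z,
      c₂ * offVal ({i₀, i₁} : Finset (Fin d)) C.1 * (c₃ * offVal ({i₀, i₁} : Finset (Fin d)) C.2) ≤
        T ^ 2 := by
    intro C hC
    obtain ⟨h1, h2⟩ := mem_product.mp hC
    rw [sq]
    exact Nat.mul_le_mul (de_mul_offVal_le hY hTY h1) (de_mul_offVal_le hZ hTZ h2)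
  calc _ ≤ (2 * L + 1) ^ 2 *
        (subBox ({i₀, i₁} : Finset (Fin d)) Y ×ˢ subBox ({i₀, i₁} : Finset (Fin d)) Z).card ^ 2 *
          Dτ ^ d :=
        de_card_inexact_aux X Q L _
          (fun C => c₂ * offVal ({i₀, i₁} : Finset (Fin d)) C.1 *
            (c₃ * offVal ({i₀, i₁} : Finset (Fin d)) C.2)) hD hL hΦ
    _ = _ := by rw [card_product]; ring

end Summit.ABC.ABC.Theorems.MazurKaneLaw
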